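import Mathlib
import Literature.Barriers.PneNP.CorrelationPolytopeXCLowerBoundGraph
import Literature.Barriers.PneNP.ExtendedFormulationMinkowskiFaces
import Literature.Barriers.PneNP.ExtendedFormulationLinearImage
import Literature.Computability.AlgebraicComplexity.NestFreeMatchingPoly
import Literature.Computability.AlgebraicComplexity.MonotoneCircuitNewtonPolytopeXC
import Literature.Algebra.Polynomial.NewtonPolytope
import Literature.Combinatorics.Optimization.GridCorCliqueFace
import Summits.ValiantsHypothesis.ValiantsHypothesis.Theorems.FifoMatchingNFPolytopeQueueGridCorProjection
import Summits.ValiantsHypothesis.ValiantsHypothesis.Theorems.FifoMatchingNFPolytopeQueueGridPPHardOfCorGridMinor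
import Summits.ValiantsHypothesis.ValiantsHypothesis.Theorems.FifoMatchingGridCorShadowZeroOnePoints
import Summits.ValiantsHypothesis.ValiantsHypothesis.Theorems.FifoMatchingNNMonomialCofactorHard
import Summits.ValiantsHypothesis.ValiantsHypothesis.Theorems.FifoMatchingXcDivisionZmixCorHard
import Summits.ValiantsHypothesis.ValiantsHypothesis.Theorems.FifoMatchingXcDivisionChamberCertificate
import Summits.ValiantsHypothesis.ValiantsHypothesis.Theorems.FifoMatchingNNDivisionHardLowDimRate
import HarnessLib

/-!
# The K1/AFHMS transport of `Newt(NN_n) + Q` WITH the passenger's NUMBER OF GENERATORS, and PROP A (the chamber certificate)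
# read in the crux's own currency (crux `Theses.FifoMatching.NNDivisionHard`, stmt-ValiantsHypothesis-21181; high-degree regime)

WHAT IS NEW.  The tree decides, in the NN currency, cofactors with FEW MONOMIALS only at the polynomial count
`|supp h|² ≤ n` (✓ `…NNDivisionHardNewtonDimension.fewMonomials_not_certificate_qp`, via `dim Newt(h) ≤ |supp h| − 1`) and
cofactors of LOW NEWTON DIMENSION `dim aff supp(h) ≤ κ√n` (✓ `…NNDivisionHardLowDimRate.nnDivisionHard_lowdim`).  At the COR level
the tree has PROP A = the CHAMBER CERTIFICATE (✓ `…XcDivisionChamberCertificate.corPolytopeGraph_top_add_hull_three_pow_le`: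
`3^h ≤ K·(r+1)·2^h` for every size-`r` extended formulation of `COR(K_h) + conv{q_1,…,q_K}` — a Minkowski passenger with few
vertices cannot destroy the Fiorini–Massar–Pokutta–Tiwary–de Wolf / Kaibel–Weltge bound), but no NN-currency reading of it: the
located-face transport `Newt(NN_n) + Q ⟶ COR(K_h) + Q'` was carried with the passenger's DIMENSION (`LowDim.transport_geometric_dim`),
not with its NUMBER OF GENERATORS.  This file carries the generator count — every transport step replaces the passenger by a linear
image of the hull of its maximising generators, so the count does not grow (`transport_step_card`, ★ `transport_geometric_card`, for an
ARBITRARY finitely generated passenger of `Newt(NN_n)`) — and reads PROP A back on `NN_n`: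

* ★ `nn_passenger_three_pow_le_card` — with AFHMS's constants `c, t₀`: for `r ≥ 1`, `n ≥ (r+1)(2r+1)`, `2g ≤ r`, `g ≥ t₀`, every
  finitely generated passenger `Q = conv{q₀ j : j ∈ J}` (e.g. the vertices of `Newt(hh)`) and every size-`s` extended formulation of
  `Newt(NN_n) + Q`: some `h ≥ c·g` has `3^h ≤ |J| · (s + 1) · 2^h`.  Read: `xc(Newt(NN_n) + Q) + 1 ≥ 1.5^{c g} / #gen(Q)`, `g = Θ(√n)`.
* ★ `nn_cofactor_three_pow_le_card`, `nn_cofactor_complexity_three_pow_le_card` — the passenger `Newt(hh)` generated by the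
  monomials of a cofactor `hh ≠ 0`: some `h ≥ c·g` has `3^h ≤ |supp hh| · (3·L₊(NN_n · hh) + 1) · 2^h` (`xc(Newt f) ≤ 3·L₊(f)`,
  HY21 Thm 35 in circuit form).  NO condition on the degrees of `hh`: this is a statement about the HIGH-DEGREE regime of record.

The route-rate / threshold forms (`corMinkowskiHard_fewGenerators`, ★★★ `nnDivisionHard_fewMonomialsExp`: cofactors with at most
`2^{κ√n}` monomials are not certificates) are in the sibling file `…NNDivisionHardFewGeneratorsExp`.

MECHANISM: K1's located face `queueGridZeroOnePoints_holds` + c1's `corMap_image_queueGridPP` + AFHMS's clique face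
`AboulkerEtAl2019_gridCorCliqueFace` (exactly as in ✓ `…LowDimRate.transport_geometric_dim`), faces and linear images distributing over
Minkowski sums (`HasEFOfSize.face_add_face₁`, `hasEFOfSize_image_add`, `convexHull_range_inter_eq`); then PROP A
(`corPolytopeGraph_top_add_hull_three_pow_le`: Yannakakis rectangles refined by the chamber of each clique row + Kaibel–Weltge).
No definitions, no named facts, no sorry.

HONEST FRAMING: transport and counting lemmas toward a restriction theorem (a decided sub-class of cofactors), NOT the crux: stmt-21181
`NNDivisionHard` (all cofactors) is OPEN — the survivors are cheap cofactors whose Newton polytopes have exponentially many vertices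
(fan-saturating passengers); COR-MINKOWSKI / COR-VIRTUAL OPEN; `NNNotVP` OPEN; `VP ≠ VNP` NOT proved; nothing here is a summit
statement.  References: Hrubeš–Yehudayoff 2021 Thm 35, §6 Problem 2 [HrubesYehudayoff2021]; Fiorini et al. 2015 Thm 7, Lemma 9
[FioriniEtAl2015]; Kaibel–Weltge 2015 Thm 1 [KaibelWeltge2014]; Aboulker–Fiorini–Huynh–Macchia–Seif 2019 [AboulkerEtAl2019 = arXiv:1806.00541].
-/

set_option autoImplicit false

-- the mandated summit-side namespace repeats a component by design (single-problem summit)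
set_option linter.dupNamespace false

noncomputable section

open Matrix Finset
open scoped Pointwise

namespace Summit.ValiantsHypothesis.ValiantsHypothesis.Theorems.FifoMatching

namespace FewGenerators

open Literature.Barriers.PneNP (HasEFOfSize sum_dotProduct_le_sum_of_valid inter_eqs_eq_inter_sum_of_valid)
open Literature.Combinatorics.Optimization (corPolytopeGraph)
open Summit.ValiantsHypothesis.ValiantsHypothesis.Theorems.FifoMatching.XcDivision
open Summit.ValiantsHypothesis.ValiantsHypothesis.Theorems.FifoMatching.LowDim (newt_inter_zeroSet_eq)

/-! ## §1 The transport WITH the passenger's number of generators -/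

section Transport

open MvPolynomial
open scoped NNReal
open Literature.Computability.AlgebraicComplexity (complexity nestFreeMatchingPoly)
open Literature.Computability.AlgebraicComplexity.MonotoneCircuitEF (hasEFOfSize_newtonPolytope_complexity)
open Literature.Algebra.Polynomial.NewtonPolytope (newtonPolytope newtonPolytope_mul)
open Summit.ValiantsHypothesis.ValiantsHypothesis.Theorems.FifoMatching.QueueGridFace
  (realOf suppPts newt QGV patternVec queueGridPP corMap corMap_image_queueGridPP newt_nonneg)
open Summit.ValiantsHypothesis.ValiantsHypothesis.Theorems.FifoMatching.GridCorShadow (queueGridZeroOnePoints_holds)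
open Summit.ValiantsHypothesis.ValiantsHypothesis.Theorems.FifoMatching.MonomialCofactor (newt_eq_newtonPolytope)
open Literature.Combinatorics.Optimization (AboulkerEtAl2019_gridCorCliqueFace)

/-- reindex a nonempty finite family by `Fin (K + 1)`, remembering `K + 1 = |J|`. [folklore] -/
theorem exists_fin_range_eq_card {α J : Type} [Fintype J] [Nonempty J] (q : J → α) :
    ∃ (K : ℕ) (q' : Fin (K + 1) → α), Set.range q' = Set.range q ∧ K + 1 = Fintype.card J := by
  obtain ⟨K, hK⟩ := Nat.exists_eq_succ_of_ne_zero (Fintype.card_ne_zero (α := J))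
  let e : J ≃ Fin (K + 1) := (Fintype.equivFin J).trans (finCongr hK)
  exact ⟨K, q ∘ e.symm, e.symm.surjective.range_comp q, hK.symm⟩

/-- **ONE TRANSPORT STEP, with the number of generators**: if `P + conv{q j : j ∈ J}` has an extended formulation of
size `r`, `w · x ≤ δ` is valid on `P` and `L` is linear, then `L(P ∩ {w · x = δ}) + conv{q'}` has an extended formulation
of size `r` for a family `q'` of at most `|J|` generators (the `L`-images of the `w`-maximising `q j`: faces and linear
images distribute over Minkowski sums). [cite: FioriniEtAl2015, Lemma 9] -/
theorem transport_step_card {ι κ J : Type} [Fintype ι] [Fintype κ] [Fintype J] [Nonempty J]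
    {P : Set (ι → ℝ)} (q : J → ι → ℝ) {r : ℕ} (h : HasEFOfSize (P + convexHull ℝ (Set.range q)) r)
    (w : ι → ℝ) (δ : ℝ) (hP : ∀ x ∈ P, w ⬝ᵥ x ≤ δ) (L : (ι → ℝ) →ₗ[ℝ] (κ → ℝ)) :
    ∃ (K : ℕ) (q' : Fin (K + 1) → κ → ℝ),
      HasEFOfSize (L '' (P ∩ {x | w ⬝ᵥ x = δ}) + convexHull ℝ (Set.range q')) r ∧
        K + 1 ≤ Fintype.card J := by
  classical
  obtain ⟨j₀, -, hj₀⟩ :=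
    Finset.exists_max_image Finset.univ (fun j => w ⬝ᵥ q j) Finset.univ_nonempty
  have hle : ∀ j, w ⬝ᵥ q j ≤ w ⬝ᵥ q j₀ := fun j => hj₀ j (Finset.mem_univ _)
  have hQ : ∀ y ∈ convexHull ℝ (Set.range q), w ⬝ᵥ y ≤ w ⬝ᵥ q j₀ :=
    dot_le_of_mem_convexHull _ w _ (by rintro _ ⟨j, rfl⟩; exact hle j)
  have h2 := hasEFOfSize_image_add (h.face_add_face₁ w δ _ hP hQ) L
  rw [convexHull_range_inter_eq q w _ hle, LinearMap.image_convexHull, ← Set.range_comp] at h2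
  haveI : Nonempty {j : J // w ⬝ᵥ q j = w ⬝ᵥ q j₀} := ⟨⟨j₀, rfl⟩⟩
  obtain ⟨K, q', hq', hK⟩ :=
    exists_fin_range_eq_card (L ∘ fun j : {j : J // w ⬝ᵥ q j = w ⬝ᵥ q j₀} => q j.1)
  refine ⟨K, q', by rw [hq']; exact h2, ?_⟩
  rw [hK]
  exact Fintype.card_subtype_le _

/-- **THE GEOMETRIC TRANSPORT WITH GENERATOR COUNT (PROVED)**: as `LowDim.transport_geometric_dim`, for an ARBITRARY finitely
generated passenger `conv{q₀ j : j ∈ J}` of `Newt(NN_n)`, and the transported passenger of `COR(K_h)` has at most `|J|` generators.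
With AFHMS's constants `c, t₀`: for `r ≥ 1`, `n ≥ (r+1)(2r+1)`, `2g ≤ r`, `g ≥ t₀` and every size-`s` extended formulation of
`Newt(NN_n) + conv{q₀}` there are `h ≥ c·g` and `q : Fin (K+1) → ℝ^{h×h}`, `K + 1 ≤ |J|`, with a size-`s` extended formulation of
`COR(K_h) + conv{q}`. [cite: AboulkerEtAl2019, pp. 5–6 (grid-minor clique face)] [cite: FioriniEtAl2015, Lemma 9] -/
theorem transport_geometric_card :
    ∃ c : ℝ, 0 < c ∧ ∃ t₀ : ℕ, ∀ (n r g : ℕ), 1 ≤ r → (r + 1) * (2 * r + 1) ≤ n → ∀ (hg : 2 * g ≤ r), t₀ ≤ g →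
      ∀ {J : Type} [Fintype J] [Nonempty J] (q₀ : J → (Fin (2 * n) × Fin (2 * n)) → ℝ) (s : ℕ),
        HasEFOfSize (newt (nestFreeMatchingPoly n ℝ≥0) + convexHull ℝ (Set.range q₀)) s →
          ∃ h : ℕ, c * g ≤ h ∧ ∃ (K : ℕ) (q : Fin (K + 1) → (Fin h × Fin h → ℝ)),
            HasEFOfSize (corPolytopeGraph (⊤ : SimpleGraph (Fin h)) + convexHull ℝ (Set.range q)) s ∧
              K + 1 ≤ Fintype.card J := by
  classical
  obtain ⟨c, hc, t₀, hface⟩ := AboulkerEtAl2019_gridCorCliqueFace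
  refine ⟨c, hc, t₀, fun n r g hr hn hg ht J _ _ q₀ s hEF' => ?_⟩
  -- Step 1: the A1 coordinate face, read out onto `PP_r`
  obtain ⟨Z, f, hA1⟩ := queueGridZeroOnePoints_holds r n hr hn
  let w : (Fin (2 * n) × Fin (2 * n)) → ℝ := fun e => if e ∈ Z then (-1 : ℝ) else 0
  have hw : ∀ x : (Fin (2 * n) × Fin (2 * n)) → ℝ, w ⬝ᵥ x = -∑ e ∈ Z, x e := by
    intro x
    simp only [dotProduct, w, ite_mul, neg_one_mul, zero_mul]
    rw [Finset.sum_ite_mem, Finset.univ_inter, Finset.sum_neg_distrib]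
  have hP : ∀ x ∈ newt (nestFreeMatchingPoly n ℝ≥0), w ⬝ᵥ x ≤ 0 := fun x hx => by
    rw [hw]; exact neg_nonpos.2 (Finset.sum_nonneg fun e _ => newt_nonneg _ x hx e)
  let Lf : ((Fin (2 * n) × Fin (2 * n)) → ℝ) →ₗ[ℝ] ((QGV r × QGV r) × Bool × Bool → ℝ) :=
    LinearMap.funLeft ℝ ℝ f
  obtain ⟨K₁, q₁, h₁, hd₁⟩ := transport_step_card q₀ hEF' w 0 hP Lf
  have hF : Lf '' (newt (nestFreeMatchingPoly n ℝ≥0) ∩ {x | w ⬝ᵥ x = 0}) = queueGridPP r := by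
    rw [newt_inter_zeroSet_eq, LinearMap.image_convexHull]
    unfold queueGridPP
    congr 1
  rw [hF] at h₁
  -- Step 2: c1's coordinate-linear map onto `COR(G_g)`
  have h₂ := hasEFOfSize_image_add h₁ (corMap r g hg)
  rw [corMap_image_queueGridPP, LinearMap.image_convexHull, ← Set.range_comp,
    ← Summit.ValiantsHypothesis.ValiantsHypothesis.Theorems.FifoMatching.QueueGridFace.corPolytopeGraph_eq] at h₂
  -- Step 3: AFHMS's face of `COR(G_g)` onto `COR(K_h)`, as ONE valid functional
  obtain ⟨h, hch, k, cv, δ, π, hvalid, hπ⟩ := hface g ht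
  obtain ⟨K₃, q₃, h₃, hd₃⟩ := transport_step_card (⇑(corMap r g hg) ∘ q₁) h₂ (∑ i, cv i) (∑ i, δ i)
    (sum_dotProduct_le_sum_of_valid _ cv δ hvalid) π
  rw [← inter_eqs_eq_inter_sum_of_valid _ cv δ hvalid, hπ] at h₃
  refine ⟨h, hch, K₃, q₃, h₃, ?_⟩
  calc K₃ + 1 ≤ Fintype.card (Fin (K₁ + 1)) := hd₃
    _ = K₁ + 1 := Fintype.card_fin _
    _ ≤ Fintype.card J := hd₁

/-- ★ **PROP A READ ON `NN_n`, FOR ANY PASSENGER (explicit form, PROVED):** with AFHMS's constants `c, t₀`: for `r ≥ 1`,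
`n ≥ (r+1)(2r+1)`, `2g ≤ r`, `g ≥ t₀`, every finitely generated passenger `Q = conv{q₀ j : j ∈ J}` and every size-`s` extended
formulation of `Newt(NN_n) + Q`, there is `h ≥ c·g` with `3^h ≤ |J| · (s + 1) · 2^h`.  Read: `xc(Newt(NN_n) + Q) + 1 ≥
1.5^{c·g} / #gen(Q)`, `g = Θ(√n)`. [cite: FioriniEtAl2015, Thm. 7] [cite: KaibelWeltge2014, Thm. 1] -/
theorem nn_passenger_three_pow_le_card :
    ∃ c : ℝ, 0 < c ∧ ∃ t₀ : ℕ, ∀ (n r g : ℕ), 1 ≤ r → (r + 1) * (2 * r + 1) ≤ n → 2 * g ≤ r → t₀ ≤ g →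
      ∀ {J : Type} [Fintype J] [Nonempty J] (q₀ : J → (Fin (2 * n) × Fin (2 * n)) → ℝ) (s : ℕ),
        HasEFOfSize (newtonPolytope (MvPolynomial.map NNReal.toRealHom (nestFreeMatchingPoly n ℝ≥0)) +
          convexHull ℝ (Set.range q₀)) s →
          ∃ h : ℕ, c * g ≤ h ∧ 3 ^ h ≤ Fintype.card J * (s + 1) * 2 ^ h := by
  obtain ⟨c, hc, t₀, H⟩ := transport_geometric_card
  refine ⟨c, hc, t₀, fun n r g hr hn hg ht J _ _ q₀ s hEF => ?_⟩
  have hEF' : HasEFOfSize (newt (nestFreeMatchingPoly n ℝ≥0) + convexHull ℝ (Set.range q₀)) s := by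
    rw [newt_eq_newtonPolytope]; exact hEF
  obtain ⟨h, hch, K, q, hq, hK⟩ := H n r g hr hn hg ht q₀ s hEF'
  refine ⟨h, hch, ?_⟩
  have hA := corPolytopeGraph_top_add_hull_three_pow_le q (Nat.succ_pos K) hq
  calc 3 ^ h ≤ (K + 1) * (s + 1) * 2 ^ h := hA
    _ ≤ Fintype.card J * (s + 1) * 2 ^ h :=
        Nat.mul_le_mul_right _ (Nat.mul_le_mul_right _ hK)

/-- ★ **PROP A READ ON `NN_n`, MONOMIAL COUNT (explicit form, PROVED):** with AFHMS's constants: for `r ≥ 1`, `n ≥ (r+1)(2r+1)`,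
`2g ≤ r`, `g ≥ t₀`, every cofactor `hh ≠ 0` and every size-`s` extended formulation of `Newt(NN_n) + Newt(hh)`, there is `h ≥ c·g`
with `3^h ≤ |supp hh| · (s + 1) · 2^h`. [cite: FioriniEtAl2015, Thm. 7] [cite: KaibelWeltge2014, Thm. 1] -/
theorem nn_cofactor_three_pow_le_card :
    ∃ c : ℝ, 0 < c ∧ ∃ t₀ : ℕ, ∀ (n r g : ℕ), 1 ≤ r → (r + 1) * (2 * r + 1) ≤ n → 2 * g ≤ r → t₀ ≤ g →
      ∀ (hh : MvPolynomial (Fin (2 * n) × Fin (2 * n)) ℝ≥0), hh ≠ 0 → ∀ s : ℕ,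
        HasEFOfSize (newtonPolytope (MvPolynomial.map NNReal.toRealHom (nestFreeMatchingPoly n ℝ≥0)) +
          newtonPolytope (MvPolynomial.map NNReal.toRealHom hh)) s →
          ∃ h : ℕ, c * g ≤ h ∧ 3 ^ h ≤ hh.support.card * (s + 1) * 2 ^ h := by
  classical
  obtain ⟨c, hc, t₀, H⟩ := nn_passenger_three_pow_le_card
  refine ⟨c, hc, t₀, fun n r g hr hn hg ht hh hh0 s hEF => ?_⟩
  haveI : Nonempty hh.support := (MvPolynomial.support_nonempty.2 hh0).coe_sort
  let q₀ : hh.support → (Fin (2 * n) × Fin (2 * n)) → ℝ := fun d => realOf d.1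
  have hS : suppPts hh = Set.range q₀ := by
    unfold suppPts; rw [Set.image_eq_range]; rfl
  have hQ : newtonPolytope (MvPolynomial.map NNReal.toRealHom hh) = convexHull ℝ (Set.range q₀) := by
    rw [← newt_eq_newtonPolytope]; unfold newt; rw [hS]
  rw [hQ] at hEF
  obtain ⟨h, hch, h3⟩ := H n r g hr hn hg ht q₀ s hEF
  refine ⟨h, hch, ?_⟩
  simpa [Fintype.card_coe] using h3

/-- ★ **… and in the crux's own currency (monotone circuit size of `NN_n · hh`)**: `Newt(NN_n · hh) = Newt NN_n + Newt hh` over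
`ℝ≥0` and `xc(Newt f) ≤ 3·L₊(f)` (HY21 Thm 35, circuit form), so `3^h ≤ |supp hh| · (3·L₊(NN_n · hh) + 1) · 2^h` for some `h ≥ c·g`.
[cite: HrubesYehudayoff2021, Theorem 35] [cite: KaibelWeltge2014, Thm. 1] -/
theorem nn_cofactor_complexity_three_pow_le_card :
    ∃ c : ℝ, 0 < c ∧ ∃ t₀ : ℕ, ∀ (n r g : ℕ), 1 ≤ r → (r + 1) * (2 * r + 1) ≤ n → 2 * g ≤ r → t₀ ≤ g →
      ∀ (hh : MvPolynomial (Fin (2 * n) × Fin (2 * n)) ℝ≥0), hh ≠ 0 →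
        ∃ h : ℕ, c * g ≤ h ∧
          3 ^ h ≤ hh.support.card * (3 * complexity (nestFreeMatchingPoly n ℝ≥0 * hh) + 1) * 2 ^ h := by
  obtain ⟨c, hc, t₀, H⟩ := nn_cofactor_three_pow_le_card
  refine ⟨c, hc, t₀, fun n r g hr hn hg ht hh hh0 => ?_⟩
  have hEF := hasEFOfSize_newtonPolytope_complexity (nestFreeMatchingPoly n ℝ≥0 * hh)
  rw [map_mul, newtonPolytope_mul] at hEF
  exact H n r g hr hn hg ht hh hh0 _ hEF

end Transport

end FewGenerators

end Summit.ValiantsHypothesis.ValiantsHypothesis.Theorems.FifoMatching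

end
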